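import Mathlib
import Literature.NumberTheory.Transcendental.KZCalculusProofs
import Literature.NumberTheory.Transcendental.KZLogCalculusProofs
import Literature.NumberTheory.Transcendental.KZSemialgebraicComplex

/-!
# `OffTetraSectorKernel`, line `odd-hyperbolic-ladder`: the dilogarithm shear (`stub_dilogShear`)

Stub `stub_dilogShear` of the crux `OffTetraSectorKernel` (stmt-KontsevichZagierPeriods-10557,
route HyperbolicBloch): for real algebraic `0 ≤ α < β ≤ 1`, the dilogarithm strip
`S = [{α < u < β, 0 < t < u}, 1/(u(1 − t))]` (value `Li₂(β) − Li₂(α)`) and the rectangle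
`R = [(α,β) × (0,1), 1/(1 − u s)]` are ONE Kontsevich–Zagier move apart: the shear
`Φ(u, s) = (u, u s)` maps the rectangle bijectively onto the strip (`u > α ≥ 0`), its derivative
at `(u, s)` is the linear map of matrix `!![1, 0; s, u]` (determinant `u > 0`), it is a polynomial
— hence `ℚ`-semialgebraic — map, and `[1/(u(1 − t))](Φ(u, s)) · |u| = 1/(1 − u s)` on the
rectangle. So `[R] − [S] ∈ KZ.changeOfVariablesRel ⊆ KZ.relations` (rule (2), source `R`,
target `S`), and `[S] − [R] = −([R] − [S])`.

The map lemmas (`dilogShear_map_*`) are adapted from the cubical chart `cub2` of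
`MzvKernelInKZ/Negative/ZetaTwo.lean` (same map on the unit square) and follow the layout of the
sibling `HyperbolicBlochOffTetraSectorKernelStubDilogLanden.lean`.

References: M. Kontsevich, D. Zagier, *Periods* (2001), §1.2 rule (2); J. Bochnak, M. Coste,
M.-F. Roy, *Real Algebraic Geometry* (1998), §2.2. No definitions are introduced.
-/

noncomputable section

open Set MeasureTheory MvPolynomial
open Literature.NumberTheory.Transcendental Literature.ModelTheory.ExponentialFields

namespace Summit.KontsevichZagierPeriods.HyperbolicBloch.OffTetraSectorKernel

/-! ### The shear `Φ(u, s) = (u, u s)` of the plane -/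

/-- First coordinate of the shear: `Φ p 0 = p 0`. [folklore] -/
theorem dilogShear_map_apply_zero (Φ : (Fin 2 → ℝ) → (Fin 2 → ℝ))
    (hΦ : ∀ p, Φ p = ![p 0, p 0 * p 1]) (p : Fin 2 → ℝ) : Φ p 0 = p 0 := by
  rw [hΦ]
  rfl

/-- Second coordinate of the shear: `Φ p 1 = p 0 * p 1`. [folklore] -/
theorem dilogShear_map_apply_one (Φ : (Fin 2 → ℝ) → (Fin 2 → ℝ))
    (hΦ : ∀ p, Φ p = ![p 0, p 0 * p 1]) (p : Fin 2 → ℝ) : Φ p 1 = p 0 * p 1 := by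
  rw [hΦ]
  rfl

/-- The shear is injective on the half-plane `{0 < u}`. [folklore] -/
theorem dilogShear_map_injOn (Φ : (Fin 2 → ℝ) → (Fin 2 → ℝ))
    (hΦ : ∀ p, Φ p = ![p 0, p 0 * p 1]) :
    InjOn Φ {p : Fin 2 → ℝ | 0 < p 0} := by
  -- adapted from `MzvKernelInKZ.Negative.injOn_cub2`
  intro a ha b hb h
  have e0 : a 0 = b 0 := by
    rw [← dilogShear_map_apply_zero Φ hΦ a, ← dilogShear_map_apply_zero Φ hΦ b, h]
  have e1' : a 0 * a 1 = b 0 * b 1 := by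
    rw [← dilogShear_map_apply_one Φ hΦ a, ← dilogShear_map_apply_one Φ hΦ b, h]
  rw [e0] at e1'
  have hb0 : (0 : ℝ) < b 0 := hb
  have e1 : a 1 = b 1 := mul_left_cancel₀ hb0.ne' e1'
  funext i
  fin_cases i
  exacts [e0, e1]

/-- The shear is a polynomial map, hence a `ℚ`-semialgebraic map on every `ℚ`-semialgebraic
set. [cite: BochnakCosteRoy1998, §2.2] -/
theorem dilogShear_map_isSemialgebraicMapOn (Φ : (Fin 2 → ℝ) → (Fin 2 → ℝ))
    (hΦ : ∀ p, Φ p = ![p 0, p 0 * p 1]) {σ : Set (Fin 2 → ℝ)} (hσ : IsSemialgebraic ℚ σ) :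
    IsSemialgebraicMapOn ℚ σ Φ := by
  -- adapted from `MzvKernelInKZ.Negative.isSemialgebraicMapOn_cub2`
  have h := isSemialgebraicMapOn_aeval hσ (![X 0, X 0 * X 1] : Fin 2 → MvPolynomial (Fin 2) ℚ)
  refine h.congr fun p _ => ?_
  rw [hΦ]
  funext j
  fin_cases j <;> simp

/-- **The image of the rectangle `(α,β) × (0,1)` under the shear** is the strip
`{α < u < β, 0 < t < u}` (`0 ≤ α`); the preimage of `(u, t)` is `(u, t/u)`. [folklore] -/
theorem dilogShear_map_image (Φ : (Fin 2 → ℝ) → (Fin 2 → ℝ))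
    (hΦ : ∀ p, Φ p = ![p 0, p 0 * p 1]) {α β : ℝ} (hα : 0 ≤ α) :
    Φ '' {w : Fin 2 → ℝ | α < w 0 ∧ w 0 < β ∧ 0 < w 1 ∧ w 1 < 1} =
      {w : Fin 2 → ℝ | α < w 0 ∧ w 0 < β ∧ 0 < w 1 ∧ w 1 < w 0} := by
  ext q
  constructor
  · rintro ⟨p, ⟨h1, h2, h3, h4⟩, rfl⟩
    simp only [mem_setOf_eq, dilogShear_map_apply_zero Φ hΦ p, dilogShear_map_apply_one Φ hΦ p]
    have hp0 : 0 < p 0 := hα.trans_lt h1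
    exact ⟨h1, h2, mul_pos hp0 h3, mul_lt_of_lt_one_right hp0 h4⟩
  · rintro ⟨h1, h2, h3, h4⟩
    have hq0 : 0 < q 0 := hα.trans_lt h1
    refine ⟨![q 0, q 1 / q 0], ?_, ?_⟩
    · simp only [mem_setOf_eq, Matrix.cons_val_zero, Matrix.cons_val_one]
      exact ⟨h1, h2, div_pos h3 hq0, (div_lt_one hq0).2 h4⟩
    · rw [hΦ]
      funext i
      fin_cases i
      · simp
      · simp [mul_div_cancel₀ _ hq0.ne']

/-- **The derivative of the shear and its determinant.** At every point `p` the linear map `L`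
of matrix `!![1, 0; p 1, p 0]` is the Fréchet derivative of `Φ`, and `det L = p 0`. [folklore] -/
theorem dilogShear_map_hasFDerivAt_det (Φ : (Fin 2 → ℝ) → (Fin 2 → ℝ))
    (hΦ : ∀ p, Φ p = ![p 0, p 0 * p 1]) (p : Fin 2 → ℝ) :
    ∃ L : (Fin 2 → ℝ) →L[ℝ] (Fin 2 → ℝ), HasFDerivAt Φ L p ∧ L.det = p 0 := by
  -- adapted from `MzvKernelInKZ.Negative.hasFDerivAt_cub2` / `det_cub2Deriv`
  set M : Matrix (Fin 2) (Fin 2) ℝ := !![1, 0; p 1, p 0] with hM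
  refine ⟨LinearMap.toContinuousLinearMap (Matrix.toLin' M), ?_, ?_⟩
  · have p0 : HasFDerivAt (fun y : Fin 2 → ℝ => y 0)
        (ContinuousLinearMap.proj (R := ℝ) (φ := fun _ : Fin 2 => ℝ) 0) p := hasFDerivAt_apply 0 p
    have p1 : HasFDerivAt (fun y : Fin 2 → ℝ => y 1)
        (ContinuousLinearMap.proj (R := ℝ) (φ := fun _ : Fin 2 => ℝ) 1) p := hasFDerivAt_apply 1 p
    refine hasFDerivAt_pi'' fun i => ?_
    fin_cases i
    · have hf : (fun x => Φ x 0) = fun y : Fin 2 → ℝ => y 0 := by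
        funext x
        exact dilogShear_map_apply_zero Φ hΦ x
      simp only [Fin.zero_eta]
      rw [hf]
      refine p0.congr_fderiv ?_
      ext v
      simp [hM, Matrix.toLin'_apply, dotProduct, Fin.sum_univ_two]
    · have hf : (fun x => Φ x 1) = fun y : Fin 2 → ℝ => y 0 * y 1 := by
        funext x
        exact dilogShear_map_apply_one Φ hΦ x
      simp only [Fin.mk_one]
      rw [hf]
      refine (p0.mul p1).congr_fderiv ?_
      ext v
      simp [hM, Matrix.toLin'_apply, dotProduct, Fin.sum_univ_two]
      ring
  · rw [LinearMap.det_toContinuousLinearMap, LinearMap.det_toLin', hM, Matrix.det_fin_two_of]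
    ring

/-- The Jacobian identity behind the move (`u ≠ 0`; with Lean's `1/0 = 0` no hypothesis on
`1 − u s` is needed): `1/(1 − u s) = 1/(u (1 − u s)) · u`. [folklore] -/
theorem dilogShear_jacobian_identity {u : ℝ} (s : ℝ) (hu : u ≠ 0) :
    1 / (1 - u * s) = 1 / (u * (1 - u * s)) * u := by
  rw [div_mul_eq_mul_div, one_mul, div_mul_cancel_left₀ hu, one_div]

/-! ### The move -/

/-- **The shear move**: for `0 ≤ α`, the rectangle `R = [(α,β) × (0,1), 1/(1 − u s)]` and the
strip `S = [{α < u < β, 0 < t < u}, 1/(u(1 − t))]` satisfy `[R] − [S] ∈ KZ.relations` — ONE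
change-of-variables move along `Φ(u, s) = (u, u s)` (Jacobian `u`).
[cite: KontsevichZagier2001, §1.2 rule (2)] -/
theorem dilogShear_rect_sub_strip {α β : ℝ} (hα : 0 ≤ α) (S R : KZ.IntegralRep 2)
    (hSd : S.domain = {w | α < w 0 ∧ w 0 < β ∧ 0 < w 1 ∧ w 1 < w 0})
    (hSi : EqOn S.integrand (fun w => 1 / (w 0 * (1 - w 1))) S.domain)
    (hRd : R.domain = {w | α < w 0 ∧ w 0 < β ∧ 0 < w 1 ∧ w 1 < 1})
    (hRi : EqOn R.integrand (fun w => 1 / (1 - w 0 * w 1)) R.domain) :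
    KZ.of R - KZ.of S ∈ KZ.relations := by
  -- the shear
  set Φ : (Fin 2 → ℝ) → (Fin 2 → ℝ) := fun p => ![p 0, p 0 * p 1]
  have hΦ : ∀ p, Φ p = ![p 0, p 0 * p 1] := fun _ => rfl
  -- on the rectangle `u > α ≥ 0`
  have hsub : R.domain ⊆ {p | 0 < p 0} := fun w hw => by
    rw [hRd] at hw
    exact hα.trans_lt hw.1
  -- the data of the move
  have hΦsa : IsSemialgebraicMapOn ℚ R.domain Φ :=
    dilogShear_map_isSemialgebraicMapOn Φ hΦ R.isSemialgebraic_domain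
  have hinj : InjOn Φ R.domain := (dilogShear_map_injOn Φ hΦ).mono hsub
  choose Φ' hΦ'd hΦ'det using dilogShear_map_hasFDerivAt_det Φ hΦ
  have hderiv : ∀ w ∈ R.domain, HasFDerivWithinAt Φ (Φ' w) R.domain w := fun w _ =>
    (hΦ'd w).hasFDerivWithinAt
  have himage : S.domain = Φ '' R.domain := by
    rw [hRd, hSd]
    exact (dilogShear_map_image Φ hΦ hα).symm
  -- rule (2): `[R] − [S]` is one change-of-variables move
  refine KZ.changeOfVariablesRel_subset_relations
    ⟨2, R, S, Φ, Φ', hΦsa, hderiv, hinj, himage, fun w hw => ?_, rfl⟩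
  have hwS : Φ w ∈ S.domain := himage ▸ mem_image_of_mem Φ hw
  have h0 : 0 < w 0 := hsub hw
  rw [hRi hw, hSi hwS, hΦ'det w, abs_of_pos h0]
  show 1 / (1 - w 0 * w 1) = 1 / (Φ w 0 * (1 - Φ w 1)) * w 0
  rw [dilogShear_map_apply_zero Φ hΦ w, dilogShear_map_apply_one Φ hΦ w]
  exact dilogShear_jacobian_identity (w 1) h0.ne'

/-! ### The stub -/

/-- STUB `stub_dilogShear` (rule (2), ONE move): the shear `(u, s) ↦ (u, u s)` of the rectangle
`(α,β) × (0,1)` onto the strip `{α < u < β, 0 < t < u}` has Jacobian `u`, and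
`u · 1/(u(1 − u s)) = 1/(1 − u s)`: so `[strip, 1/(u(1−t))] ≡ [(α,β)×(0,1), 1/(1−us)]` (for
`α = 0` the strip is the dilogarithm triangle `T(β)`). The move `[R] − [S]` is
`dilogShear_rect_sub_strip`; `[S] − [R]` is its negative. [cite: KontsevichZagier2001, §1.2 rule (2)] -/
theorem stub_dilogShear :
    ∀ (α β : ℝ), IsAlgebraic ℚ α → IsAlgebraic ℚ β → 0 ≤ α → α < β → β ≤ 1 →
    ∀ (S R : KZ.IntegralRep 2),
      S.domain = {w | α < w 0 ∧ w 0 < β ∧ 0 < w 1 ∧ w 1 < w 0} →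
      Set.EqOn S.integrand (fun w => 1 / (w 0 * (1 - w 1))) S.domain →
      R.domain = {w | α < w 0 ∧ w 0 < β ∧ 0 < w 1 ∧ w 1 < 1} →
      Set.EqOn R.integrand (fun w => 1 / (1 - w 0 * w 1)) R.domain →
      KZ.of S - KZ.of R ∈ KZ.relations := by
  intro α β _ _ hα _ _ S R hSd hSi hRd hRi
  have h := KZ.relations.neg_mem (dilogShear_rect_sub_strip hα S R hSd hSi hRd hRi)
  rwa [neg_sub] at h

end Summit.KontsevichZagierPeriods.HyperbolicBloch.OffTetraSectorKernel

end
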